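import Literature.NumberTheory.Transcendental.CalegariDimitrovTangL2Chi3
import Mathlib.Analysis.SpecialFunctions.Sqrt
import Mathlib.Tactic
import HarnessLib

/-!
# Calegari–Dimitrov–Tang, Theorem 1 — the overconvergence mechanism of §11.1 (Remark on
Beukers-type integrals), proved

Sibling of `CalegariDimitrovTangL2Chi3.lean` (named fact
`Literature.NumberTheory.Transcendental.calegariDimitrovTang_linearIndependent`, CDT 2024
Thm. 1) and of `CalegariDimitrovTangL2Chi3Proofs.lean` (Zagier's sequences). Step 1 of the
printed proof of Thm. 1 (§13) needs the `G`-function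
`H(x) = b(H_B − ½L(2,χ₋₃)H_A) + c(H_C − ¼ζ(2)H_A)` to *overconverge*: radius of convergence `1`
instead of `1/9`, indeed analyticity on `ℂ ∖ [1,∞)`. CDT (§11.1, Remark following
Prop. "functionsH", eqs. (Cintegral), (Aintegral), (boundary singularity as a max), (Erep),
p. 102) make this "transparent" through Beukers-type double integrals:
`L(2,χ₋₃)H_A(x) − 2H_B(x) = Σₙ xⁿ ∬_{[0,1]²} (9st(1−s³)(1−t³))ⁿ / (1+st+s²t²)^{2n+1} ds dt`,
`ζ(2)G_A(x) − 4G_C(x) = Σₙ xⁿ (−1)ⁿ ∬_{[0,1]²} ((1−s²)(1−t²))ⁿ / (1−st)^{n+1} ds dt`, together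
with the two **peak-rate computations**
`max_{[0,1]²} |9st(1−s³)(1−t³)/(1+st+s²t²)²| = 1` (attained at `s = t = 1/2`) and
`max_{[0,1]²} |(1−s²)(1−t²)/(1−st)| = 1` (attained at `s = t = 0`), "from which it follows that
the integrals are all bounded by `1`", whence convergence on the unit disc.

This file PROVES the two peak-rate computations (the elementary inequalities, with the cases of
equality) and the resulting bound `≤ 1/(1+st+s²t²) ≤ 1` resp. `≤ 1/(1−st)`-free bound `≤ 1` on
the integrands. The integral identities (Cintegral)/(Aintegral) themselves (a creative
telescoping of double integrals, "by hand using a little effort or by [AZ]") are NOT here.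
No named facts (D-0026).

## The inequality behind the first peak rate

With `s = u²`, `t = v²` (`u, v ∈ [0,1]`) and `q = uv`:
`(1−u⁶)(1−v⁶) ≤ (1−q³)²` (difference `(u³−v³)²`) and
`(1+q²+q⁴)² − 9q²(1−q³)² = (2q−1)²(q²+q+1)(1+3q+q²−2q⁴) ≥ 0` on `[0,1]`, with equality iff
`q = 1/2`; so `9st(1−s³)(1−t³) ≤ (1+st+s²t²)²`, equality at `s = t = 1/2` (value `441/256` on
both sides).

## References

* [CalegariDimitrovTang2024] arXiv:2408.15403, §11.1, Remark after Prop. "functionsH"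
  (eqs. (Cintegral), (Aintegral), (boundary singularity as a max), (Erep)), p. 102.
-/

open Set

namespace Literature.NumberTheory.Transcendental

namespace CalegariDimitrovTang

/-! ### First peak rate: `9st(1−s³)(1−t³) ≤ (1+st+s²t²)²` on the unit square -/

/-- The one-variable inequality behind the first peak rate: for `0 ≤ q ≤ 1`,
`9q²(1−q³)² ≤ (1+q²+q⁴)²`, because the difference factors as
`(2q−1)²(q²+q+1)(1+3q+q²−2q⁴)` with the last factor `≥ 1` on `[0,1]`. [folklore] -/
theorem nine_mul_sq_mul_sq_le {q : ℝ} (hq0 : 0 ≤ q) (hq1 : q ≤ 1) :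
    9 * q ^ 2 * (1 - q ^ 3) ^ 2 ≤ (1 + q ^ 2 + q ^ 4) ^ 2 := by
  have hfac : (1 + q ^ 2 + q ^ 4) ^ 2 - 9 * q ^ 2 * (1 - q ^ 3) ^ 2
      = (2 * q - 1) ^ 2 * (q ^ 2 + q + 1) * (1 + 3 * q + q ^ 2 - 2 * q ^ 4) := by ring
  have h1 : 0 ≤ (2 * q - 1) ^ 2 * (q ^ 2 + q + 1) := by positivity
  have h2 : 1 ≤ 1 + 3 * q + q ^ 2 - 2 * q ^ 4 := by
    have hq4 : q ^ 4 ≤ q := by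
      calc q ^ 4 ≤ q ^ 1 := pow_le_pow_of_le_one hq0 hq1 (by norm_num)
        _ = q := pow_one q
    nlinarith [sq_nonneg q]
  nlinarith [mul_le_mul_of_nonneg_left h2 h1]

/-- **First peak-rate inequality** (CDT eq. (boundary singularity as a max), first half): for
`s, t ∈ [0,1]`, `9st(1−s³)(1−t³) ≤ (1 + st + s²t²)²`. Proof: substitute `s = u²`, `t = v²`,
bound `(1−u⁶)(1−v⁶) ≤ (1−u³v³)²`, and apply `nine_mul_sq_mul_sq_le` with `q = uv`.
[cite: CalegariDimitrovTang2024, §11.1 eq. (boundary singularity as a max) (p. 102)] -/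
theorem peakRate_chi3_le {s t : ℝ} (hs : s ∈ Icc (0 : ℝ) 1) (ht : t ∈ Icc (0 : ℝ) 1) :
    9 * s * t * (1 - s ^ 3) * (1 - t ^ 3) ≤ (1 + s * t + s ^ 2 * t ^ 2) ^ 2 := by
  obtain ⟨hs0, hs1⟩ := hs
  obtain ⟨ht0, ht1⟩ := ht
  -- square roots
  set u := Real.sqrt s with hu
  set v := Real.sqrt t with hv
  have hu0 : 0 ≤ u := Real.sqrt_nonneg s
  have hv0 : 0 ≤ v := Real.sqrt_nonneg t
  have hsu : s = u ^ 2 := by rw [hu, Real.sq_sqrt hs0]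
  have htv : t = v ^ 2 := by rw [hv, Real.sq_sqrt ht0]
  have hu1 : u ≤ 1 := by rw [hu]; exact Real.sqrt_le_one.mpr hs1 |>.trans_eq rfl
  have hv1 : v ≤ 1 := by rw [hv]; exact Real.sqrt_le_one.mpr ht1 |>.trans_eq rfl
  rw [hsu, htv]
  set q := u * v with hq
  have hq0 : 0 ≤ q := mul_nonneg hu0 hv0
  have hq1 : q ≤ 1 := by rw [hq]; exact mul_le_one₀ hu1 hv0 hv1
  -- `(1−u⁶)(1−v⁶) ≤ (1−q³)²`
  have hAMGM : (1 - (u ^ 2) ^ 3) * (1 - (v ^ 2) ^ 3) ≤ (1 - q ^ 3) ^ 2 := by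
    rw [hq]; nlinarith [sq_nonneg (u ^ 3 - v ^ 3)]
  have h9 : 0 ≤ 9 * u ^ 2 * v ^ 2 := by positivity
  have hmain := nine_mul_sq_mul_sq_le hq0 hq1
  calc 9 * u ^ 2 * v ^ 2 * (1 - (u ^ 2) ^ 3) * (1 - (v ^ 2) ^ 3)
      = 9 * u ^ 2 * v ^ 2 * ((1 - (u ^ 2) ^ 3) * (1 - (v ^ 2) ^ 3)) := by ring
    _ ≤ 9 * u ^ 2 * v ^ 2 * (1 - q ^ 3) ^ 2 := mul_le_mul_of_nonneg_left hAMGM h9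
    _ = 9 * q ^ 2 * (1 - q ^ 3) ^ 2 := by rw [hq]; ring
    _ ≤ (1 + q ^ 2 + q ^ 4) ^ 2 := hmain
    _ = (1 + u ^ 2 * v ^ 2 + (u ^ 2) ^ 2 * (v ^ 2) ^ 2) ^ 2 := by rw [hq]; ring

/-- **First peak rate, as printed**: on `[0,1]²` the Beukers-type kernel
`9st(1−s³)(1−t³)/(1+st+s²t²)²` has absolute value `≤ 1` …
[cite: CalegariDimitrovTang2024, §11.1 eq. (boundary singularity as a max) (p. 102)] -/
theorem abs_peakRate_chi3_le_one {s t : ℝ} (hs : s ∈ Icc (0 : ℝ) 1) (ht : t ∈ Icc (0 : ℝ) 1) :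
    |9 * s * t * (1 - s ^ 3) * (1 - t ^ 3) / (1 + s * t + s ^ 2 * t ^ 2) ^ 2| ≤ 1 := by
  obtain ⟨hs0, hs1⟩ := hs
  obtain ⟨ht0, ht1⟩ := ht
  have hden : 0 < (1 + s * t + s ^ 2 * t ^ 2) ^ 2 := by positivity
  have hnum0 : 0 ≤ 9 * s * t * (1 - s ^ 3) * (1 - t ^ 3) := by
    have : s ^ 3 ≤ 1 := pow_le_one₀ hs0 hs1
    have : t ^ 3 ≤ 1 := pow_le_one₀ ht0 ht1
    have : 0 ≤ 1 - s ^ 3 := by linarith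
    have : 0 ≤ 1 - t ^ 3 := by linarith
    positivity
  rw [abs_of_nonneg (div_nonneg hnum0 hden.le), div_le_one hden]
  exact peakRate_chi3_le ⟨hs0, hs1⟩ ⟨ht0, ht1⟩

/-- … and the value `1` is attained at `s = t = 1/2` (both sides of `peakRate_chi3_le` equal
`441/256` there), so the maximum over `[0,1]²` is exactly `1`.
[cite: CalegariDimitrovTang2024, §11.1 eq. (boundary singularity as a max) (p. 102)] -/
theorem peakRate_chi3_half :
    9 * (1 / 2 : ℝ) * (1 / 2) * (1 - (1 / 2) ^ 3) * (1 - (1 / 2) ^ 3)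
      / (1 + (1 / 2) * (1 / 2) + (1 / 2) ^ 2 * (1 / 2) ^ 2) ^ 2 = 1 := by
  norm_num

/-- **The maximum is `1`** (printed form): `1` is the greatest value of
`|9st(1−s³)(1−t³)/(1+st+s²t²)²|` on `[0,1]²`.
[cite: CalegariDimitrovTang2024, §11.1 eq. (boundary singularity as a max) (p. 102)] -/
theorem isGreatest_peakRate_chi3 :
    IsGreatest ((fun p : ℝ × ℝ =>
      |9 * p.1 * p.2 * (1 - p.1 ^ 3) * (1 - p.2 ^ 3) / (1 + p.1 * p.2 + p.1 ^ 2 * p.2 ^ 2) ^ 2|) ''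
        (Icc (0 : ℝ) 1 ×ˢ Icc (0 : ℝ) 1)) 1 := by
  refine ⟨⟨(1 / 2, 1 / 2), ⟨⟨by norm_num, by norm_num⟩, ⟨by norm_num, by norm_num⟩⟩, ?_⟩, ?_⟩
  · simp only
    rw [peakRate_chi3_half, abs_one]
  · rintro y ⟨p, ⟨hp1, hp2⟩, rfl⟩
    exact abs_peakRate_chi3_le_one hp1 hp2

/-- Consequently the `n`-th Beukers-type integrand of (Cintegral) is dominated, on `[0,1]²`, by
the `n = 0` one: `(9st(1−s³)(1−t³))ⁿ/(1+st+s²t²)^{2n+1} ≤ 1/(1+st+s²t²) ≤ 1` — "the integrals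
are all bounded by `1`", which is the unit-disc convergence of `L(2,χ₋₃)H_A − 2H_B`.
[cite: CalegariDimitrovTang2024, §11.1, Remark after Prop. "functionsH" (p. 102)] -/
theorem beukersKernel_chi3_pow_le_one {s t : ℝ} (hs : s ∈ Icc (0 : ℝ) 1) (ht : t ∈ Icc (0 : ℝ) 1)
    (n : ℕ) :
    (9 * s * t * (1 - s ^ 3) * (1 - t ^ 3)) ^ n / (1 + s * t + s ^ 2 * t ^ 2) ^ (2 * n + 1)
      ≤ 1 := by
  obtain ⟨hs0, hs1⟩ := hs
  obtain ⟨ht0, ht1⟩ := ht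
  have hD1 : 1 ≤ 1 + s * t + s ^ 2 * t ^ 2 := by nlinarith [mul_nonneg hs0 ht0]
  have hD0 : 0 < 1 + s * t + s ^ 2 * t ^ 2 := by linarith
  have hnum0 : 0 ≤ 9 * s * t * (1 - s ^ 3) * (1 - t ^ 3) := by
    have : s ^ 3 ≤ 1 := pow_le_one₀ hs0 hs1
    have : t ^ 3 ≤ 1 := pow_le_one₀ ht0 ht1
    have : 0 ≤ 1 - s ^ 3 := by linarith
    have : 0 ≤ 1 - t ^ 3 := by linarith
    positivity
  have hle := peakRate_chi3_le ⟨hs0, hs1⟩ ⟨ht0, ht1⟩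
  rw [div_le_one (by positivity)]
  calc (9 * s * t * (1 - s ^ 3) * (1 - t ^ 3)) ^ n
      ≤ ((1 + s * t + s ^ 2 * t ^ 2) ^ 2) ^ n := pow_le_pow_left₀ hnum0 hle n
    _ = (1 + s * t + s ^ 2 * t ^ 2) ^ (2 * n) * 1 := by rw [← pow_mul, mul_one]
    _ ≤ (1 + s * t + s ^ 2 * t ^ 2) ^ (2 * n) * (1 + s * t + s ^ 2 * t ^ 2) :=
        mul_le_mul_of_nonneg_left hD1 (by positivity)
    _ = (1 + s * t + s ^ 2 * t ^ 2) ^ (2 * n + 1) := (pow_succ _ _).symm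

/-! ### Second peak rate: `(1−s²)(1−t²) ≤ 1 − st` on the unit square -/

/-- **Second peak-rate inequality** (CDT eq. (boundary singularity as a max), second half): for
`s, t ∈ [0,1]`, `0 ≤ (1−s²)(1−t²) ≤ (1−st)² ≤ 1 − st` (the middle step is `(s−t)² ≥ 0`).
[cite: CalegariDimitrovTang2024, §11.1 eq. (boundary singularity as a max) (p. 102)] -/
theorem peakRate_A_le {s t : ℝ} (hs : s ∈ Icc (0 : ℝ) 1) (ht : t ∈ Icc (0 : ℝ) 1) :
    (1 - s ^ 2) * (1 - t ^ 2) ≤ 1 - s * t := by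
  obtain ⟨hs0, hs1⟩ := hs
  obtain ⟨ht0, ht1⟩ := ht
  have hst1 : s * t ≤ 1 := mul_le_one₀ hs1 ht0 ht1
  have hst0 : 0 ≤ s * t := mul_nonneg hs0 ht0
  have h1 : (1 - s ^ 2) * (1 - t ^ 2) ≤ (1 - s * t) ^ 2 := by nlinarith [sq_nonneg (s - t)]
  have h2 : (1 - s * t) ^ 2 ≤ 1 - s * t := by nlinarith
  exact h1.trans h2

/-- **Second peak rate, as printed**: `|(1−s²)(1−t²)/(1−st)| ≤ 1` on `[0,1]²` (at the corner
`s = t = 1` the quotient is `0/0`, read as `0` by Mathlib's convention and as a removable `0` by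
continuity in print) …
[cite: CalegariDimitrovTang2024, §11.1 eq. (boundary singularity as a max) (p. 102)] -/
theorem abs_peakRate_A_le_one {s t : ℝ} (hs : s ∈ Icc (0 : ℝ) 1) (ht : t ∈ Icc (0 : ℝ) 1) :
    |(1 - s ^ 2) * (1 - t ^ 2) / (1 - s * t)| ≤ 1 := by
  obtain ⟨hs0, hs1⟩ := hs
  obtain ⟨ht0, ht1⟩ := ht
  have hnum0 : 0 ≤ (1 - s ^ 2) * (1 - t ^ 2) := by
    have : s ^ 2 ≤ 1 := pow_le_one₀ hs0 hs1
    have : t ^ 2 ≤ 1 := pow_le_one₀ ht0 ht1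
    have : 0 ≤ 1 - s ^ 2 := by linarith
    have : 0 ≤ 1 - t ^ 2 := by linarith
    positivity
  have hden0 : 0 ≤ 1 - s * t := by nlinarith [mul_le_one₀ hs1 ht0 ht1]
  rcases hden0.eq_or_lt with h0 | hpos
  · rw [← h0, div_zero, abs_zero]; exact zero_le_one
  · rw [abs_of_nonneg (div_nonneg hnum0 hpos.le), div_le_one hpos]
    exact peakRate_A_le ⟨hs0, hs1⟩ ⟨ht0, ht1⟩

/-- … with the value `1` attained at `s = t = 0`, so the maximum over `[0,1]²` is exactly `1`.
[cite: CalegariDimitrovTang2024, §11.1 eq. (boundary singularity as a max) (p. 102)] -/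
theorem isGreatest_peakRate_A :
    IsGreatest ((fun p : ℝ × ℝ => |(1 - p.1 ^ 2) * (1 - p.2 ^ 2) / (1 - p.1 * p.2)|) ''
        (Icc (0 : ℝ) 1 ×ˢ Icc (0 : ℝ) 1)) 1 := by
  refine ⟨⟨(0, 0), ⟨⟨le_rfl, zero_le_one⟩, ⟨le_rfl, zero_le_one⟩⟩, by norm_num⟩, ?_⟩
  rintro y ⟨p, ⟨hp1, hp2⟩, rfl⟩
  exact abs_peakRate_A_le_one hp1 hp2

/-- Consequently the `n`-th integrand of (Aintegral) is dominated on `[0,1]²` (off the corner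
`s = t = 1`) by the `n = 0` one: `((1−s²)(1−t²))ⁿ/(1−st)^{n+1} ≤ 1/(1−st)`.
[cite: CalegariDimitrovTang2024, §11.1, Remark after Prop. "functionsH" (p. 102)] -/
theorem beukersKernel_A_pow_le {s t : ℝ} (hs : s ∈ Icc (0 : ℝ) 1) (ht : t ∈ Icc (0 : ℝ) 1)
    (hst : s * t < 1) (n : ℕ) :
    ((1 - s ^ 2) * (1 - t ^ 2)) ^ n / (1 - s * t) ^ (n + 1) ≤ 1 / (1 - s * t) := by
  obtain ⟨hs0, hs1⟩ := hs
  obtain ⟨ht0, ht1⟩ := ht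
  have hpos : 0 < 1 - s * t := by linarith
  have hnum0 : 0 ≤ (1 - s ^ 2) * (1 - t ^ 2) := by
    have : s ^ 2 ≤ 1 := pow_le_one₀ hs0 hs1
    have : t ^ 2 ≤ 1 := pow_le_one₀ ht0 ht1
    have : 0 ≤ 1 - s ^ 2 := by linarith
    have : 0 ≤ 1 - t ^ 2 := by linarith
    positivity
  have hle := peakRate_A_le ⟨hs0, hs1⟩ ⟨ht0, ht1⟩
  rw [div_le_div_iff₀ (by positivity) hpos, one_mul, pow_succ]
  exact mul_le_mul_of_nonneg_right (pow_le_pow_left₀ hnum0 hle n) hpos.le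

end CalegariDimitrovTang

end Literature.NumberTheory.Transcendental
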